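import Summits.BirchSwinnertonDyer.Rank1Residual.O5.FlexNormalFormIsogenous
import Summits.BirchSwinnertonDyer.Rank1Residual.O5.FlexNFCaseSKodairaLawThreeProofs
import Literature.NumberTheory.DiophantineGeometry.TateAlgorithmExitMinimalityProofs
import Literature.NumberTheory.DiophantineGeometry.MinimalDiscriminantSmulProofs
import HarnessLib

/-!
# T31 Case S of the flex normal form at `3` — part 1/2: the isogenous column `E′ = E/⟨P₀⟩` on
# J. Top's square model `Y² = X³ − 27(bX − 4M)²` (`M = b³ − 3ᵃA₃`, `3 ∤ A₃`), the cells with `3 ∤ b`: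
# `a = 1` ⟹ Kodaira `IV*`, `v₃Δ_min = 10`; `a = 2` ⟹ `II*`, `v₃Δ_min = 11` — Tate's algorithm in the kernel
# (cell `b2b-bsdres`, team n1011, ROW T-FLEX-KOD FILE 2a; seat `b2b-bsdres-n1011-p18` GEN 13 under the idle
#  rule; skeleton `cells/n1011/skel/T-FLEX-KOD.md`; theorems only; part 2 = `FlexNFIsogenousCaseSKodairaLawThreeProofs`)

HONEST FRAMING (cell `b2b-bsdres`, run/shared/lean/b2b/bsd-rank1-residual/, verbatim in every file): the
goal of the cell is to DELETE the COMBINATION-SHAPED residual classes of the Birch–Swinnerton-Dyer formula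
for ALL analytic-rank `≤ 1` elliptic curves over `ℚ` — "full BSD formula for every rank `≤ 1` curve in
class `C`" assembled STRICTLY from published theorems — so that the rank-`≤ 1` remainder becomes exactly
the CONSTRUCTION-SHAPED classes, which are TYPED (missing-input `Prop`s), NOT attempted. This is not
"finishing BSD". Lane CLASS-CLOSURE / O5 (O5 OPEN): research route; census output (P-K20) is EVIDENCE,
never a Literature fact; nothing is booked; no mark of `RESIDUAL-MAP.md` moves. This file: THEOREMS ONLY
(no definition, no named fact, no `@[conjecture]` node, no `sorry`; net named-fact debt `0`); nothing of
cc-typer-5's / o5-r1's files is edited; a `_holds` theorem for a conjecture node closes NO pair and moves NO mark.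

## What is proved

For `b A₃ : ℤ` with `3 ∤ A₃`, `a ∈ {1, 2}`, `M := b³ − 3ᵃA₃`, on o5-r1 GEN 14's
`isoQ b A₃ a = ⟨0, −27b², 0, 216bM, −432M²⟩ / ℚ` (T31; `≅ E/⟨P₀⟩` by `half_smul_velu`), at `Additive.placeOf 3`:

* §0 two plumbing tools on top of FILE 1's `kodairaSymbolAt_and_ordMinimalDiscriminant_placeOf_three_of_intModel`:
  `isMinimalAt_of_cast_kodairaSymbolOfMinimal_ne` — MINIMALITY FROM THE EXIT (if Tate's algorithm on the
  cast integer model returns anything but `I₀`, the model is minimal; tree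
  `isMinimal_baseChange_of_kodairaSymbolOfMinimal_ne_I_zero`, *ATAEC* IV.9.4 Step 11 read forwards), for the
  cell `v₃Δ = 13` of part 2; `kodairaSymbolAt_and_ordMinimalDiscriminant_of_smul_eq_baseChange` — type and
  `ord Δ_min` read on any `ℚ`-isomorphic model (`kodairaSymbol_smul_holds`, `ordMinimalDiscriminant_smul_holds`),
  for the non-minimal cell `v₃Δ = 17` of part 2.
* §1 the integer models: `isoQ` is the base change of `isoModel b M : WeierstrassCurve ℤ`;
  `Δ = 2¹²·3^{9+a}·A₃·M³`; the TRANSLATE `x ↦ x + 3bM` (`(u, r, s, t) = (1, 3bM, 0, 0)`):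
  `[0, 9(bM − 3b²), 0, 27·bM·(8 − 6b² + bM), 27·M²·(b³M − 9b⁴ + 24b² − 16)]`, used with the identities
  `b³M − 9b⁴ + 24b² − 16 = (b² − 1)(b² − 4)² − 3ᵃb³A₃`, `8 − 6b² + bM = (b² − 2)(b² − 4) − 3ᵃbA₃`, and
  `27 ∣ (b² − 1)(b² − 4)²`, `3 ∣ (b² − 2)(b² − 4)` for `3 ∤ b`; small `3`-divisibility bookkeeping.
* §2 the two cells with `3 ∤ b` (Silverman *ATAEC* IV.9.4 on the translate):
  `a = 1`: Step 8, quadratic `Y² − a₆/81` with `a₆/81 ≡ −M²b³A₃ ≢ 0` ⟹ **IV***, `v₃Δ_min = 10`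
  (`kodairaSymbolAt_and_ord_isoQ_one_of_not_dvd`); `a = 2`: Steps 9–10, `3⁴ ∣ a₄`, `3⁵ ∥ a₆` ⟹ **II***,
  `v₃Δ_min = 11` (`kodairaSymbolAt_and_ord_isoQ_two_of_not_dvd`).

Not claimed here: the cells `3 ∣ b` and the node (part 2); the `c` / `a(φ̂)` fields of `isoS`; Case N.

References: J. H. Silverman, *Advanced Topics in the Arithmetic of Elliptic Curves*, GTM 151 (1994), IV.9.4
Steps 1–11, Table 4.1 [SilvermanATAEC1994]; J. H. Silverman, *The Arithmetic of Elliptic Curves*, GTM 106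
(2009), III.1 Table 3.1, VII.1 Prop. 1.3, Remark 1.1 [SilvermanAEC2009]; J. Top, *Descent by 3-isogeny and
3-rank of quadratic fields*, in Advances in Number Theory (1993) §3 p. 306 [Top1993DescentByThreeIsogeny];
o5-r1 GEN 14 `T31-ISOGENOUS-COLUMN.md` §1 (hand proof), census P-K20 (EVIDENCE).
-/

open scoped NumberField

open IsDedekindDomain Rat.HeightOneSpectrum WeierstrassCurve NumberField
  Literature.NumberTheory.EllipticCurves Literature.NumberTheory.GaloisRepresentations
  Literature.NumberTheory.DiophantineGeometry Literature.NumberTheory.DiophantineGeometry.TateAlgorithm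
  Summit.BirchSwinnertonDyer.BirchSwinnertonDyer.Rank2Observatory.Tate
  Summit.BirchSwinnertonDyer.Rank1Residual

namespace Summit.BirchSwinnertonDyer.Rank1Residual.O5.FlexNormalForm.Isogenous

/-! ## §0 Two more plumbing tools: minimality from the exit; reading on an isomorphic model -/

/-- **Minimality from the exit of Tate's algorithm, for an integer model at a place of `𝓞 ℚ`.**  If in
every presentation `p = ϖε` of `O_v` the literal algorithm returns something other than `I₀` on the cast
of `M`, then `M ⊗ ℚ` is a minimal equation at `v` (*ATAEC* IV.9.4: Step 11 is reached iff the equation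
is not minimal; tree `isMinimal_baseChange_of_kodairaSymbolOfMinimal_ne_I_zero`).
[cite: SilvermanATAEC1994, IV.9.4 Step 11 (PDF pp. 346, 354–355)] -/
theorem isMinimalAt_of_cast_kodairaSymbolOfMinimal_ne (v : HeightOneSpectrum (𝓞 ℚ)) {p : ℕ}
    (hv : natGenerator v = p) (M : WeierstrassCurve ℤ)
    (hT : ∀ ε : v.adicCompletionIntegers ℚ, IsUnit ε →
      (p : v.adicCompletionIntegers ℚ) = uniformizer (v.adicCompletionIntegers ℚ) * ε →
      (M.map (Int.castRingHom (v.adicCompletionIntegers ℚ))).kodairaSymbolOfMinimal ≠ .I 0) :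
    (M.baseChange ℚ).IsMinimalAt v := by
  haveI := perfectField_residueField_adicCompletionIntegers (K := ℚ) v
  have hpval : Valued.v (((p : v.adicCompletionIntegers ℚ)) : v.adicCompletion ℚ) =
      WithZero.exp (-((1 : ℕ) : ℤ)) := by
    rw [show ((p : v.adicCompletionIntegers ℚ) : v.adicCompletion ℚ) =
        algebraMap _ (v.adicCompletion ℚ) (p : v.adicCompletionIntegers ℚ) from rfl, map_natCast,
      ← map_natCast (algebraMap ℚ (v.adicCompletion ℚ)) p,
      WeierstrassCurve.valued_algebraMap_adicCompletion, ← hv]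
    exact_mod_cast Rat.valuation_natGenerator v
  obtain ⟨ε, hε, hpε⟩ := exists_isUnit_eq_uniformizer_pow_mul_of_valued_eq v hpval
  rw [pow_one] at hpε
  have hmin := isMinimal_baseChange_of_kodairaSymbolOfMinimal_ne_I_zero (K := v.adicCompletion ℚ)
    (M.map (Int.castRingHom (v.adicCompletionIntegers ℚ))) (hT ε hε hpε)
  have e : (M.map (Int.castRingHom (v.adicCompletionIntegers ℚ))).baseChange (v.adicCompletion ℚ) =
      (M.baseChange ℚ).baseChange (v.adicCompletion ℚ) := by
    simp only [WeierstrassCurve.baseChange, WeierstrassCurve.map_map]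
    congr 1
    exact RingHom.ext_int _ _
  show ((M.baseChange ℚ).baseChange (v.adicCompletion ℚ)).IsMinimal (v.adicCompletionIntegers ℚ)
  rw [← e]; exact hmin

/-- **Kodaira type and `ord Δ_min` read on a `ℚ`-isomorphic model**: if `C • W = R₀ ⊗ ℚ` then the two
curves have the same Kodaira symbol and the same `ord₃ Δ_min` at `Additive.placeOf 3` (isomorphism
invariance: `kodairaSymbol_smul_holds`, `ordMinimalDiscriminant_smul_holds`; Tate 1975 §§7–8, *AEC* VII.1).
[cite: SilvermanATAEC1994, IV.9.4] [cite: SilvermanAEC2009, VII.1 Prop. 1.3(b)] -/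
theorem kodairaSymbolAt_and_ordMinimalDiscriminant_of_smul_eq_baseChange (W : WeierstrassCurve ℚ)
    [W.IsElliptic] (C : VariableChange ℚ) (R₀ : WeierstrassCurve ℤ) (h : C • W = R₀.baseChange ℚ)
    {T : KodairaSymbol} {n : ℕ}
    (hR : (R₀.baseChange ℚ).kodairaSymbolAt (Additive.placeOf 3) = T ∧
      (R₀.baseChange ℚ).ordMinimalDiscriminant (Additive.placeOf 3) = n) :
    W.kodairaSymbolAt (Additive.placeOf 3) = T ∧ W.ordMinimalDiscriminant (Additive.placeOf 3) = n := by
  haveI : PerfectField (IsLocalRing.ResidueField ((Additive.placeOf 3).adicCompletionIntegers ℚ)) :=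
    PerfectField.ofFinite
  rw [← h] at hR
  have hK : (C • W).kodairaSymbolAt (Additive.placeOf 3) = W.kodairaSymbolAt (Additive.placeOf 3) := by
    have hs := kodairaSymbol_smul_holds ((Additive.placeOf 3).adicCompletionIntegers ℚ)
      (K := (Additive.placeOf 3).adicCompletion ℚ)
    simp only [kodairaSymbolAt, WeierstrassCurve.baseChange, ← map_variableChange, hs]
  rw [hK, ordMinimalDiscriminant_smul_holds (Additive.placeOf 3) W C] at hR
  exact hR

/-! ## §1 The integer models -/

/-- `isoQ b A₃ a` is the base change of the INTEGER model `isoModel b (b³ − 3ᵃA₃)`. [folklore] -/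
theorem isoQ_eq_baseChange (b A₃ : ℤ) (a : ℕ) :
    isoQ b A₃ a = (isoModel b (b ^ 3 - 3 ^ a * A₃) : WeierstrassCurve ℤ).baseChange ℚ := by
  ext <;> simp [isoQ, isoModel, WeierstrassCurve.baseChange, WeierstrassCurve.map]

/-- `Δ(isoModel b M) = 2¹²·3^{9+a}·(A₃·M³)` for `M = b³ − 3ᵃA₃` (`isoModel_Δ`: `2¹²3⁹(b³ − M)M³`). [folklore] -/
theorem isoModel_int_Δ (b A₃ : ℤ) (a : ℕ) :
    (isoModel b (b ^ 3 - 3 ^ a * A₃) : WeierstrassCurve ℤ).Δ =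
      3 ^ (9 + a) * (2 ^ 12 * (A₃ * (b ^ 3 - 3 ^ a * A₃) ^ 3)) := by
  rw [isoModel_Δ]; ring

/-- The coefficients and discriminant of the TRANSLATE `x ↦ x + 3bM` (`(u, r, s, t) = (1, 3bM, 0, 0)`) of
`isoModel b M`: `[0, 9(bM − 3b²), 0, 27·bM·(8 − 6b² + bM), 27·M²·(b³M − 9b⁴ + 24b² − 16)]`, same `Δ`.
[cite: SilvermanAEC2009, III.1 Table 3.1] -/
theorem translate_eqs (b M : ℤ) :
    ((⟨1, 3 * (b * M), 0, 0⟩ : VariableChange ℤ) • isoModel b M).a₁ = 0 ∧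
    ((⟨1, 3 * (b * M), 0, 0⟩ : VariableChange ℤ) • isoModel b M).a₂ = 9 * (b * M - 3 * b ^ 2) ∧
    ((⟨1, 3 * (b * M), 0, 0⟩ : VariableChange ℤ) • isoModel b M).a₃ = 0 ∧
    ((⟨1, 3 * (b * M), 0, 0⟩ : VariableChange ℤ) • isoModel b M).a₄ =
      27 * (b * M * (8 - 6 * b ^ 2 + b * M)) ∧
    ((⟨1, 3 * (b * M), 0, 0⟩ : VariableChange ℤ) • isoModel b M).a₆ =
      27 * (M ^ 2 * (b ^ 3 * M - 9 * b ^ 4 + 24 * b ^ 2 - 16)) ∧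
    ((⟨1, 3 * (b * M), 0, 0⟩ : VariableChange ℤ) • isoModel b M).Δ = (isoModel b M).Δ := by
  refine ⟨?_, ?_, ?_, ?_, ?_, ?_⟩
  · simp [variableChange_a₁, isoModel]
  · simp [variableChange_a₂, isoModel]; ring
  · simp [variableChange_a₃, isoModel]
  · simp [variableChange_a₄, isoModel]; ring
  · simp [variableChange_a₆, isoModel]; ring
  · rw [variableChange_Δ]; simp

/-- `3 ∤ b ⟹ 3 ∣ b² − 1`. [folklore] -/
theorem three_dvd_sq_sub_one {b : ℤ} (hb : ¬ (3 : ℤ) ∣ b) : (3 : ℤ) ∣ b ^ 2 - 1 := by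
  have hx : ((b : ZMod 3)) ≠ 0 := by
    rw [Ne, ZMod.intCast_zmod_eq_zero_iff_dvd]; exact_mod_cast hb
  have key : ∀ x : ZMod 3, x ≠ 0 → x ^ 2 - 1 = 0 := by decide
  have h := (ZMod.intCast_zmod_eq_zero_iff_dvd (b ^ 2 - 1) 3).mp (by push_cast; exact key _ hx)
  exact_mod_cast h

/-- `3 ∤ b ⟹ 27 ∣ (b² − 1)(b² − 4)²`. [folklore] -/
theorem dvd_Q {b : ℤ} (hb : ¬ (3 : ℤ) ∣ b) : (27 : ℤ) ∣ (b ^ 2 - 1) * (b ^ 2 - 4) ^ 2 := by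
  obtain ⟨m, hm⟩ := three_dvd_sq_sub_one hb
  have h4 : b ^ 2 - 4 = 3 * (m - 1) := by linear_combination hm
  exact ⟨m * (m - 1) ^ 2, by rw [hm, h4]; ring⟩

/-- `3 ∤ b ⟹ 3 ∣ (b² − 2)(b² − 4)`. [folklore] -/
theorem dvd_P {b : ℤ} (hb : ¬ (3 : ℤ) ∣ b) : (3 : ℤ) ∣ (b ^ 2 - 2) * (b ^ 2 - 4) := by
  obtain ⟨m, hm⟩ := three_dvd_sq_sub_one hb
  have h4 : b ^ 2 - 4 = 3 * (m - 1) := by linear_combination hm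
  exact ⟨(b ^ 2 - 2) * (m - 1), by rw [h4]; ring⟩

/-- `3 ∤ A₃`, `3 ∤ b`, `1 ≤ a` ⟹ `3 ∤ M = b³ − 3ᵃA₃`. [folklore] -/
theorem not_three_dvd_M {b A₃ : ℤ} {a : ℕ} (ha : 1 ≤ a) (hb : ¬ (3 : ℤ) ∣ b) :
    ¬ (3 : ℤ) ∣ b ^ 3 - 3 ^ a * A₃ := by
  intro h
  have h3a : (3 : ℤ) ∣ 3 ^ a * A₃ := dvd_mul_of_dvd_left (dvd_pow_self 3 (by omega)) _
  have hb3 : (3 : ℤ) ∣ b ^ 3 := by simpa using dvd_add h h3a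
  exact hb (Int.prime_three.dvd_of_dvd_pow hb3)

/-- `3 ∤ x, 3 ∤ y ⟹ 3 ∤ x·y`. [folklore] -/
theorem not_three_dvd_mul {x y : ℤ} (hx : ¬ (3 : ℤ) ∣ x) (hy : ¬ (3 : ℤ) ∣ y) :
    ¬ (3 : ℤ) ∣ x * y :=
  fun h ↦ (Int.prime_three.dvd_or_dvd h).elim hx hy

/-- `3 ∤ x ⟹ 3 ∤ xⁿ`. [folklore] -/
theorem not_three_dvd_pow {x : ℤ} (hx : ¬ (3 : ℤ) ∣ x) (n : ℕ) : ¬ (3 : ℤ) ∣ x ^ n :=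
  fun h ↦ hx (Int.prime_three.dvd_of_dvd_pow h)

/-- If `3 ∤ u` then `3ⁿ⁺¹ ∤ 3ⁿ·u`. [folklore] -/
theorem not_pow_succ_dvd_pow_mul' {u : ℤ} (n : ℕ) (hu : ¬ (3 : ℤ) ∣ u) :
    ¬ (3 : ℤ) ^ (n + 1) ∣ 3 ^ n * u := by
  rintro ⟨k, hk⟩
  refine hu ⟨k, ?_⟩
  have h3 : (3 : ℤ) ^ n ≠ 0 := pow_ne_zero _ (by norm_num)
  apply mul_left_cancel₀ h3
  rw [hk, pow_succ]; ring

/-- `3 ∤ 2¹²`. [folklore] -/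
theorem not_three_dvd_two_pow : ¬ (3 : ℤ) ∣ 2 ^ 12 := by decide

/-- `(3 : ℕ)ᵏ ∣ 3ᵏ·x` in `ℤ` (cast bookkeeping for the integer-model engine). [folklore] -/
theorem natCast_pow_dvd_mul (k : ℕ) (x : ℤ) : ((3 : ℕ) : ℤ) ^ k ∣ 3 ^ k * x := by
  push_cast; exact dvd_mul_right _ _

/-- `¬ 3ᵏ⁺¹ ∣ y` in `ℤ` transported to the cast exponent base `(3 : ℕ)`. [folklore] -/
theorem not_natCast_pow_dvd {k : ℕ} {y : ℤ} (h : ¬ (3 : ℤ) ^ (k + 1) ∣ y) :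
    ¬ ((3 : ℕ) : ℤ) ^ (k + 1) ∣ y := by
  push_cast; exact h

/-- `3 ∤ b`: `3^{9+a} ∥ Δ(isoModel b M)`. [folklore] -/
theorem pow_dvd_isoΔ_of_not_dvd {b A₃ : ℤ} {a : ℕ} (ha : 1 ≤ a) (hA : ¬ (3 : ℤ) ∣ A₃) (hb : ¬ (3 : ℤ) ∣ b) :
    (3 : ℤ) ^ (9 + a) ∣ (isoModel b (b ^ 3 - 3 ^ a * A₃) : WeierstrassCurve ℤ).Δ ∧
      ¬ (3 : ℤ) ^ (9 + a + 1) ∣ (isoModel b (b ^ 3 - 3 ^ a * A₃) : WeierstrassCurve ℤ).Δ := by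
  rw [isoModel_int_Δ]
  exact ⟨dvd_mul_right _ _, not_pow_succ_dvd_pow_mul' _ (not_three_dvd_mul not_three_dvd_two_pow
    (not_three_dvd_mul hA (not_three_dvd_pow (not_three_dvd_M ha hb) 3)))⟩

/-! ## §2 The two cells with `3 ∤ b` (the cells `3 ∣ b` and the node are in part 2) -/

/-- **`3 ∤ b`, `a = 1`: type `IV*` at `3`, `ord₃ Δ_min = 10`.**  On the translate: `9 ∣ a₂`, `27 ∣ a₄`,
`81 ∣ a₆ = 27M²((b²−1)(b²−4)² − 3b³A₃)`, and the Step-8 quadratic `Y² − a₆/81` has two distinct roots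
since `a₆/81 ≡ −M²b³A₃ ≢ 0 (mod 3)`. [cite: SilvermanATAEC1994, IV.9.4 Steps 6–8] -/
theorem kodairaSymbolAt_and_ord_isoQ_one_of_not_dvd (b A₃ : ℤ) (hA : ¬ (3 : ℤ) ∣ A₃) (hb : ¬ (3 : ℤ) ∣ b) :
    (isoQ b A₃ 1).kodairaSymbolAt (Additive.placeOf 3) = .IVstar ∧
      (isoQ b A₃ 1).ordMinimalDiscriminant (Additive.placeOf 3) = 10 := by
  rw [isoQ_eq_baseChange]
  set M := b ^ 3 - 3 ^ 1 * A₃ with hM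
  obtain ⟨hΔ, hΔ'⟩ := pow_dvd_isoΔ_of_not_dvd (a := 1) le_rfl hA hb
  rw [← hM] at hΔ hΔ'
  obtain ⟨e1, e2, e3, e4, e6, eΔ⟩ := translate_eqs b M
  set T := (⟨1, 3 * (b * M), 0, 0⟩ : VariableChange ℤ) • isoModel b M with hT
  have hΔT : (3 : ℤ) ^ 10 ∣ T.Δ := by rw [eΔ]; exact hΔ
  have hΔT' : ¬ (3 : ℤ) ^ (10 + 1) ∣ T.Δ := by rw [eΔ]; exact hΔ'
  have hMu : ¬ (3 : ℤ) ∣ M := not_three_dvd_M (a := 1) le_rfl hb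
  -- the key identities on the translate
  obtain ⟨q, hq⟩ := dvd_Q hb
  have key6 : b ^ 3 * M - 9 * b ^ 4 + 24 * b ^ 2 - 16 = 3 * (9 * q - b ^ 3 * A₃) := by
    have : b ^ 3 * M - 9 * b ^ 4 + 24 * b ^ 2 - 16 = (b ^ 2 - 1) * (b ^ 2 - 4) ^ 2 - 3 * b ^ 3 * A₃ := by
      rw [hM]; ring
    rw [this, hq]; ring
  have ha₆ : T.a₆ = 3 ^ 4 * (M ^ 2 * (9 * q - b ^ 3 * A₃)) := by rw [e6, key6]; ring
  refine kodairaSymbolAt_and_ordMinimalDiscriminant_placeOf_three_of_intModel (isoModel b M) T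
    ⟨1, 3 * (b * M), 0, 0⟩ rfl rfl
    (fun v' hv' ↦ isMinimalAt_of_criterion v' hv' T hΔT hΔT' (Or.inl (by norm_num))) hΔT hΔT' ?_
  intro v' ε hε hpε
  haveI := perfectField_residueField_adicCompletionIntegers (K := ℚ) v'
  refine kodairaSymbolOfMinimal_intCast_eq_IVstar Nat.prime_three hε hpε ?_ ?_ ?_ ?_ ?_ ?_
  · rw [e1]; exact dvd_zero _
  · rw [e2]; exact ⟨b * M - 3 * b ^ 2, by push_cast; ring⟩
  · rw [e3]; exact dvd_zero _
  · rw [e4]; exact ⟨b * M * (8 - 6 * b ^ 2 + b * M), by push_cast; ring⟩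
  · rw [ha₆]; exact natCast_pow_dvd_mul 4 _
  · rw [e3, ha₆]
    have h81 : ((3 : ℕ) : ℤ) ^ 4 = 3 ^ 4 := by norm_num
    rw [h81, Int.mul_ediv_cancel_left _ (by norm_num : (3 : ℤ) ^ 4 ≠ 0)]
    norm_num
    -- `3 ∤ 4·M²·(9q − b³A₃)`
    intro h
    have h' : (3 : ℤ) ∣ M ^ 2 * (9 * q - b ^ 3 * A₃) := by
      rcases Int.prime_three.dvd_or_dvd h with h4 | h4
      · exact absurd h4 (by decide)
      · exact h4
    refine not_three_dvd_mul (not_three_dvd_pow hMu 2) ?_ h'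
    intro h9
    have : (3 : ℤ) ∣ b ^ 3 * A₃ := by
      have h27 : (3 : ℤ) ∣ 9 * q := Dvd.intro (3 * q) (by ring)
      simpa using dvd_sub h27 h9
    exact not_three_dvd_mul (not_three_dvd_pow hb 3) hA this

/-- **`3 ∤ b`, `a = 2`: type `II*` at `3`, `ord₃ Δ_min = 11`.**  On the translate: `9 ∣ a₂`, `27 ∣ a₃ = 0`,
`81 ∣ a₄ = 27bM((b²−2)(b²−4) − 9bA₃)`, `3⁵ ∥ a₆ = 27M²((b²−1)(b²−4)² − 9b³A₃)`.
[cite: SilvermanATAEC1994, IV.9.4 Steps 6–10] -/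
theorem kodairaSymbolAt_and_ord_isoQ_two_of_not_dvd (b A₃ : ℤ) (hA : ¬ (3 : ℤ) ∣ A₃) (hb : ¬ (3 : ℤ) ∣ b) :
    (isoQ b A₃ 2).kodairaSymbolAt (Additive.placeOf 3) = .IIstar ∧
      (isoQ b A₃ 2).ordMinimalDiscriminant (Additive.placeOf 3) = 11 := by
  rw [isoQ_eq_baseChange]
  set M := b ^ 3 - 3 ^ 2 * A₃ with hM
  obtain ⟨hΔ, hΔ'⟩ := pow_dvd_isoΔ_of_not_dvd (a := 2) (by norm_num) hA hb
  rw [← hM] at hΔ hΔ'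
  obtain ⟨e1, e2, e3, e4, e6, eΔ⟩ := translate_eqs b M
  set T := (⟨1, 3 * (b * M), 0, 0⟩ : VariableChange ℤ) • isoModel b M with hT
  have hΔT : (3 : ℤ) ^ 11 ∣ T.Δ := by rw [eΔ]; exact hΔ
  have hΔT' : ¬ (3 : ℤ) ^ (11 + 1) ∣ T.Δ := by rw [eΔ]; exact hΔ'
  have hMu : ¬ (3 : ℤ) ∣ M := not_three_dvd_M (a := 2) (by norm_num) hb
  obtain ⟨q, hq⟩ := dvd_Q hb
  obtain ⟨p, hp⟩ := dvd_P hb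
  have key6 : b ^ 3 * M - 9 * b ^ 4 + 24 * b ^ 2 - 16 = 9 * (3 * q - b ^ 3 * A₃) := by
    have : b ^ 3 * M - 9 * b ^ 4 + 24 * b ^ 2 - 16 = (b ^ 2 - 1) * (b ^ 2 - 4) ^ 2 - 9 * b ^ 3 * A₃ := by
      rw [hM]; ring
    rw [this, hq]; ring
  have key4 : 8 - 6 * b ^ 2 + b * M = 3 * (p - 3 * b * A₃) := by
    have : 8 - 6 * b ^ 2 + b * M = (b ^ 2 - 2) * (b ^ 2 - 4) - 9 * b * A₃ := by rw [hM]; ring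
    rw [this, hp]; ring
  have ha₆ : T.a₆ = 3 ^ 5 * (M ^ 2 * (3 * q - b ^ 3 * A₃)) := by rw [e6, key6]; ring
  have ha₄ : T.a₄ = 3 ^ 4 * (b * M * (p - 3 * b * A₃)) := by rw [e4, key4]; ring
  refine kodairaSymbolAt_and_ordMinimalDiscriminant_placeOf_three_of_intModel (isoModel b M) T
    ⟨1, 3 * (b * M), 0, 0⟩ rfl rfl
    (fun v' hv' ↦ isMinimalAt_of_criterion v' hv' T hΔT hΔT' (Or.inl (by norm_num))) hΔT hΔT' ?_
  intro v' ε hε hpε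
  haveI := perfectField_residueField_adicCompletionIntegers (K := ℚ) v'
  refine kodairaSymbolOfMinimal_intCast_eq_IIstar Nat.prime_three hε hpε ?_ ?_ ?_ ?_ ?_ ?_
  · rw [e1]; exact dvd_zero _
  · rw [e2]; exact ⟨b * M - 3 * b ^ 2, by push_cast; ring⟩
  · rw [e3]; exact dvd_zero _
  · rw [ha₄]; exact natCast_pow_dvd_mul 4 _
  · rw [ha₆]; exact natCast_pow_dvd_mul 5 _
  · rw [ha₆]
    refine not_natCast_pow_dvd (not_pow_succ_dvd_pow_mul' 5 (not_three_dvd_mul (not_three_dvd_pow hMu 2) ?_))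
    intro h9
    have : (3 : ℤ) ∣ b ^ 3 * A₃ := by
      have h27 : (3 : ℤ) ∣ 3 * q := Dvd.intro q rfl
      simpa using dvd_sub h27 h9
    exact not_three_dvd_mul (not_three_dvd_pow hb 3) hA this

end Summit.BirchSwinnertonDyer.Rank1Residual.O5.FlexNormalForm.Isogenous
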